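import Mathlib
import HarnessLib
import Literature.Computability.AlgebraicComplexity.NewtonPolygonTauProofs
import Summits.ValiantsHypothesis.ValiantsHypothesis.Theses.NewtonFrames
import Summits.ValiantsHypothesis.ValiantsHypothesis.Theorems.NewtonFramesBlockConvexBoundOfThreeSetBound
import Summits.ValiantsHypothesis.ValiantsHypothesis.Theorems.NewtonFramesNewtonTauWeakBlockConvexThree
import Summits.ValiantsHypothesis.ValiantsHypothesis.Theorems.NewtonFramesCappedSlopeSum
import Summits.ValiantsHypothesis.ValiantsHypothesis.Theorems.NewtonFramesLowParallelismCapReduction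
import Summits.ValiantsHypothesis.ValiantsHypothesis.Theorems.NewtonFramesLowParallelismDictionary
import Summits.ValiantsHypothesis.ValiantsHypothesis.Theorems.NewtonFramesCartesianIncidenceBound

/-!
# Line `low-parallelism` — crux `NewtonTauWeak` (stmt-ValiantsHypothesis-5904), lens = nearmiss (val-idea-12 g2, D-0145/D-0148)

BEARS ON the rung `BeatTwoThirds` of the line of record `Lines/slope_ladder.lean` (`∃ c < 2/3, SlopeBound c`; FRONTIER
disposition: convex geometry, not a step toward VP ≠ VNP) through the LAW `ThreeSetBound` of line `landing_collapse.lean` (U1 there,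
OPEN) and the LANDED chain `Theorems.…LandingCollapse.beatTwoThirds_of_threeSetBound` (p600179) ∘ `SlopeLadderBlocking.stub_blocking`
(p578760).  Card: `Lines/low-parallelism.md`; crux idea: `Ideas/low-parallelism.md`.

THE MEASURED NEAR-MISS, LOCALISED.  The exponent deficit `7/3` (constructions: Farey–parabola `BlockConvexFarey.farey_parabola_main`,
p593702; the capped slope-height count `CappedSlopeSum.stub_cappedSlopeSumRung`, p601033, tight) versus `8/3` (the only bound in play:
Eisenbrand–Pach–Rothvoß–Sopher / Szemerédi–Trotter) lives ENTIRELY inside the PARABOLIC CASE of `ThreeSetBound`: hull curve a parabola,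
`P₁` on it, `P₂` vertical.  In the coordinates `Φ(x,y) = (x, y - x²)` this case is, verbatim (`parabolaDictionary`, PROVED), a count of
LANDINGS `a + μ/2` over the incidences of a CARTESIAN PRODUCT `A × B` (`#A, #B ≤ n`) with `≤ n²` non-vertical LINES `y = μx + ν`
(translates ↦ lines) — the classical object of structural Szemerédi–Trotter theory (Elekes, Solymosi, Sheffer–Silier, Rudnev–Shkredov,
Petridis–Roche-Newton–Rudnev–Warren).

THE LEVER — THE PARALLELISM CAP.  Landings are injective in (slope, abscissa): a slope contributes at most `#A ≤ n` landings however
many parallel lines carry it.  Hence (`capReduction`, PROVED): slopes carrying `> K` lines are `≤ n²/K` in number and cost `≤ n³/K` in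
total WITH NO STRUCTURE THEOREM, and a count `≥ n^{8/3-θ}` forces `≥ n^{8/3-θ}` genuine INCIDENCES on the sub-family of lines whose
slopes carry `≤ K = n^{1/3+θ}` lines each.  The inverse problem of line `landing-collapse` ("near-extremal ⇒ grid-like") is thereby
replaced, on its parabolic core, by a FORWARD incidence law for LOW-PARALLELISM line sets:

THE SINGLE INPUT TO IMPROVE = `LowParallelismLaw` (STUB 1, the crux of this line, 0 provers): for some `θ > 0`, `n²` lines with
`≤ n^{1/3+θ}` lines per slope have `≤ C n^{8/3-θ}` incidences with an `n × n` Cartesian product.  Literature position: every known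
Szemerédi–Trotter-extremal configuration on a Cartesian product has `Θ(N^{1/3})` slopes carrying `Θ(N^{2/3})` parallel lines each, and
whether others exist is the question Sheffer–Silier leave open (arXiv:2110.09692, after Thm 1.3; Thm 1.4 = parallel-or-concurrent
families for `n^α × n^{1-α}`, `1/3 < α < 1/2`, degenerate exactly at the square case `α = 1/2` needed here); the very-rich regime
(`n^{1-δ}`-rich lines) is Solymosi's Conjecture 3.10 / Borenstein–Croot 2010 Thm 2; the affine-energy route (Rudnev–Shkredov incidence
bound `I ≲ |B|^{1/2}|A|^{2/3}E(L)^{1/6}|L|^{1/3}`, PRNRW `E(L) ≲ m^{1/2}|L|^{5/2} + M|L|²`, arXiv:1911.03401 Thm 2.1/2.3) reproduces exactly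
`n^{8/3}` at parallelism `m = 1` and bites only for lines richer than `n^{2/3} m^{1/3}` — the medium-rich regime `r ≍ n^{2/3-θ}` is open.
WHY IT MIGHT FAIL: `≥ n^{2/3-θ}` simultaneously rich PENCILS (centres `z` with `#((B - y_z)/(A - x_z)) ≤ n^{4/3+θ}`), excluded by pinned
sum-product only qualitatively (Bourgain–Chang type), would give `n^{8/3-θ}` incidences at parallelism `O(1)`.

WITNESS (STUB 2 `stub_gridWitness`, PROVED here from `CappedSlopeSum.card_linePts_le` / `mem_lowSlopes`): on Farey's home turf
`A = B = [n]` a line set with `≤ K` lines per slope has `≤ n(2H+1)H·K + #L((n-1)/(H+1)+1)` incidences for every height cut `H`, i.e.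
`O(K^{1/3} n^{7/3}) = O(n^{22/9+θ/3}) ≤ n^{8/3-θ}` for `K = n^{1/3+θ}`, `θ ≤ 1/6`: the law holds with room exactly where `7/3` is attained.

STATUS (rev 5, 2026-08-28: rev 4 + the `θ = 0` endpoint `lawAt_zero` / `landingLawAt_zero` PROVED BY NAME from the elementary
Cartesian Szemerédi–Trotter helper `Theorems/NewtonFramesCartesianIncidenceBound.lean` (p612872); rev 4 came after critic VERDICT #12 PASS-WITH-PRICE; price P5 PAID: the proved part is LANDED in the tree, sorry-free,
TWICE (collision, RULING g12-R129 (b)/R132 (c)): `Theorems/NewtonFramesLowParallelismCapReduction.lean` (p609939) +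
`Theorems/NewtonFramesLowParallelismDictionary.lean` (p609936) by 5904-lc2 g4 (namespace `…Theorems.NewtonFramesNewtonTauWeak.LowParallelism`,
decl names = this file's), and `Theorems/NewtonFramesNewtonTauWeakLowParallelismCap.lean` (p609870) + `…NewtonTauWeakParabolaDictionary.lean`
(p609960) by val-idea-12 g2; §1/§4/§5 below cite the lc2 pair BY NAME (the copy with hub oleans at wiring time; the other pair is an
unreferenced twin with the same statements): `lean check` rc 0; sorries 3 = `stub_lowParallelismLandingLaw`
(THE REGISTERED LAW in LANDING form — price P1: same hypotheses, conclusion on `#landings`; `landingLaw_of_law : LowParallelismLaw → ·`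
proved, so the incidence form above stays the literature-facing strengthening; `landingLaw_iff_cartesianParabolaBound` proved — the law IS
the rung in "WLOG low parallelism" form, so a kill is informative both ways) + `stub_cartesianParabolaWorstCase`
(declared residual₁: the Cartesian–parabola configurations are the worst case of `ThreeSetBound`; never staffed — for a non-parabolic hull
curve the complement is a unit-distance-type problem) + `stub_residualSlope` (declared residual₂ of the record).  PROVED here:
`capReductionLanding : LowParallelismLandingLaw → CartesianParabolaBound` (U2; `capReduction` from the incidence law), `parabolaDictionary :
ThreeSetBound → CartesianParabolaBound` (on-path: the rung is a NECESSARY sub-case of `ThreeSetBound` — residual₁, its converse, is a SECOND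
OPEN implication, price P2, never dischargeable by routine), `stub_gridWitness : GridLowParallelism`; rev 2: `card_incTriples_pencil_le` and the
typed split `lawAt_of_split` (general position + rich pencils ⇒ incidence law, glue proved).  Compositions BY NAME: `threeSetBound_of(Landing)`,
`beatTwoThirds_of(Landing)`, `NewtonTauWeak_of(Landing) : law → CartesianParabolaWorstCase → ResidualSlope → Theses.NewtonFrames.NewtonTauWeak`.

VP ≠ VNP is NOT moved: the rung is FRONTIER-disposition incidence geometry, three declared implications below the crux.

Disproof used / dead lines honoured: no aligned peeling (`Negative.AlignedPeelingCex.not_exists_alignedPeeling` — nothing is peeled; the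
heavy slopes are bounded by counting, the light ones by a global law); bound shape untouched (`SlopeBound c` only; Root/Quasi/Subexp shapes are
summit-strength); `BlockConvexCeiling.stub_witness_delta_le` (`δ ≤ 1/6`) respected: `η = θ` feeds `δ = η/4`; `CappedSlopeSum` tightness
(`7/3` attained) caps any `η` in `CartesianParabolaBound` at `1/3`, consistent with `θ` small; negatives index (28) — no incidence statement.
-/

noncomputable section

open scoped BigOperators Pointwise
open MvPolynomial
open Literature.Computability.AlgebraicComplexity (newtonVertexCount)

set_option linter.dupNamespace false

namespace Summit.ValiantsHypothesis.ValiantsHypothesis.Cruxes.NewtonTauWeak.LowParallelism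

/-! ### 0. The frame, verbatim from the line of record `slope_ladder` / `landing_collapse` -/

/-- `SlopeLadder.SlopeBound c`, verbatim. -/
def SlopeBound (c : ℝ) : Prop :=
  ∃ (C : ℝ) (b : ℕ), ∀ (k m t : ℕ) (f : Fin k → Fin m → MvPolynomial (Fin 2) ℂ),
    (∀ i j, (f i j).support.card ≤ t) →
      (newtonVertexCount (∑ i, ∏ j, f i j) : ℝ) ≤
        C * ((k : ℝ) + 2) ^ b * 2 ^ (b * m) * ((t : ℝ) + 2) ^ b * ((t : ℝ) + 2) ^ (c * (m : ℝ))

/-- THE RUNG of the line of record (`SlopeLadder.BeatTwoThirds`, verbatim). -/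
def BeatTwoThirds : Prop := ∃ c : ℝ, c < 2 / 3 ∧ SlopeBound c

/-- `LandingCollapse.ThreeSetBound`, verbatim (the LAW of line `landing-collapse`; this line attacks its parabolic core). -/
def ThreeSetBound : Prop :=
  ∃ (η C : ℝ), 0 < η ∧
    ∀ (n : ℕ) (P₁ P₂ Y S : Finset (Fin 2 → ℝ)),
      P₁.card ≤ n → P₂.card ≤ n → Y.card ≤ n ^ 2 → S ⊆ P₁ + P₂ + Y →
        ConvexIndependent ℝ (Subtype.val : ↥(S : Set (Fin 2 → ℝ)) → (Fin 2 → ℝ)) →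
          (S.card : ℝ) ≤ C * ((n : ℝ) + 2) ^ ((8 : ℝ) / 3 - η)

/-- The declared residual of the line of record (`SlopeLadder.ResidualSlope`, verbatim): never staffed. -/
def ResidualSlope : Prop :=
  BeatTwoThirds → Summit.ValiantsHypothesis.ValiantsHypothesis.Theses.NewtonFrames.NewtonTauWeak

/-! ### 1. The Cartesian–parabola dictionary: objects -/

/-- Incidence triples `((a,b),(μ,ν))`: `a ∈ A`, `b ∈ B`, `(μ,ν) ∈ L` and the point `(a,b)` lies on the (non-vertical)
line `y = μ x + ν`.  Their number is `I(A × B, L)`. -/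
def incTriples (A B : Finset ℝ) (L : Finset (ℝ × ℝ)) : Finset ((ℝ × ℝ) × (ℝ × ℝ)) :=
  ((A ×ˢ B) ×ˢ L).filter fun q => q.1.2 = q.2.1 * q.1.1 + q.2.2

/-- LANDINGS: the abscissae `a + μ/2` of the incidence triples.  Under `Φ(x,y) = (x, y - x²)` these are exactly the points
`(x, x²)` of the parabola lying in `{(a,a²)} + {(0,b)} + {(μ/2, μ²/4 - ν)}` (see `parabolaDictionary`). -/
def landings (A B : Finset ℝ) (L : Finset (ℝ × ℝ)) : Finset ℝ :=
  (incTriples A B L).image fun q => q.1.1 + q.2.1 / 2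

/-- Parallelism multiplicity: the number of lines of `L` with slope `μ`. -/
def slopeMult (L : Finset (ℝ × ℝ)) (μ : ℝ) : ℕ := (L.filter fun l => l.1 = μ).card

/-! ### 2. Statements -/

/-- THE CARTESIAN–PARABOLA RUNG (the parabolic core of `ThreeSetBound`, where the measured deficit lives: Farey gives
`7/3` — `BlockConvexFarey.farey_parabola_main`, `CappedSlopeSum` — and Szemerédi–Trotter gives `8/3`):
for some `η > 0`, `#landings(A,B,L) ≤ C (n+2)^{8/3-η}` whenever `#A, #B ≤ n`, `#L ≤ n²`. -/
def CartesianParabolaBound : Prop :=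
  ∃ (η C : ℝ), 0 < η ∧ ∀ (n : ℕ) (A B : Finset ℝ) (L : Finset (ℝ × ℝ)),
    A.card ≤ n → B.card ≤ n → L.card ≤ n ^ 2 →
      ((landings A B L).card : ℝ) ≤ C * ((n : ℝ) + 2) ^ ((8 : ℝ) / 3 - η)

/-- **THE LAW of this line (its crux; 0 provers): LOW-PARALLELISM LINE SETS ARE NOT SZEMERÉDI–TROTTER-EXTREMAL ON
CARTESIAN PRODUCTS.**  For some `θ > 0`: if `#A, #B ≤ n`, `#L ≤ n²` and no slope carries more than `(n+2)^{1/3+θ}` lines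
of `L`, then `I(A × B, L) ≤ C (n+2)^{8/3-θ}`.  (The gap side of the question Sheffer–Silier leave open after
arXiv:2110.09692 Thm 1.3: every known Szemerédi–Trotter-extremal configuration on a Cartesian product consists of
`Θ(N^{1/3})` families of `Θ(N^{2/3})` PARALLEL lines.) -/
def LowParallelismLaw : Prop :=
  ∃ (θ C : ℝ), 0 < θ ∧ ∀ (n : ℕ) (A B : Finset ℝ) (L : Finset (ℝ × ℝ)),
    A.card ≤ n → B.card ≤ n → L.card ≤ n ^ 2 →
      (∀ μ : ℝ, (slopeMult L μ : ℝ) ≤ ((n : ℝ) + 2) ^ ((1 : ℝ) / 3 + θ)) →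
        ((incTriples A B L).card : ℝ) ≤ C * ((n : ℝ) + 2) ^ ((8 : ℝ) / 3 - θ)

/-- **THE REGISTERED LAW (rev 3, critic val-idea-crit-3 VERDICT #12 price P1): the LANDING form.**  Same hypotheses as
`LowParallelismLaw`, conclusion on LANDINGS `#{a + μ/2}` instead of incidences.  It is implied by the incidence law
(`landingLaw_of_law`, landings ≤ incidences) and it is EQUIVALENT to the rung `CartesianParabolaBound`
(`landingLaw_iff_cartesianParabolaBound`: `→` is the cap reduction, `←` drops the hypothesis) — i.e. the proved content of the
lever is exactly "WLOG the line set has parallelism `≤ (n+2)^{1/3+θ}`", and a refutation of THIS statement refutes the rung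
(and, through `parabolaDictionary`, `ThreeSetBound`), whereas a refutation of the incidence form alone would not. -/
def LowParallelismLandingLaw : Prop :=
  ∃ (θ C : ℝ), 0 < θ ∧ ∀ (n : ℕ) (A B : Finset ℝ) (L : Finset (ℝ × ℝ)),
    A.card ≤ n → B.card ≤ n → L.card ≤ n ^ 2 →
      (∀ μ : ℝ, (slopeMult L μ : ℝ) ≤ ((n : ℝ) + 2) ^ ((1 : ℝ) / 3 + θ)) →
        ((landings A B L).card : ℝ) ≤ C * ((n : ℝ) + 2) ^ ((8 : ℝ) / 3 - θ)

/-- WITNESS (the law on Farey's home turf, PROVABLE now from `Theorems.…CappedSlopeSum.card_linePts_le`): on the grid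
`A = B = {0,…,n-1}`, a line set with `≤ K` lines per slope has, for every height cut `H`,
`I ≤ n·(2H+1)H·K + #L·((n-1)/(H+1) + 1)` incidences (low slopes: `≤ (2H+1)H` of them, `≤ K` lines each, `≤ n` points per
line; high slopes: `≤ (n-1)/(H+1)+1` points per line).  With `K = n^{1/3+θ}`, `H = (n²/K)^{1/3}` this is
`O(n^{22/9+θ/3}) ≤ n^{8/3-θ}` for `θ ≤ 1/6`. -/
def GridLowParallelism : Prop :=
  ∀ (n K H : ℕ) (L : Finset (ℝ × ℝ)), (∀ μ : ℝ, slopeMult L μ ≤ K) →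
    (incTriples ((Finset.range n).image (fun i : ℕ => (i : ℝ))) ((Finset.range n).image (fun i : ℕ => (i : ℝ))) L).card
      ≤ n * ((2 * H + 1) * H) * K + L.card * ((n - 1) / (H + 1) + 1)

/-- DECLARED RESIDUAL₁ (never staffed): the Cartesian–parabola configurations are the worst case of `ThreeSetBound` up
to the exponent.  (The parabola is the unique strictly convex curve whose family of translates is a family of LINES in
suitable coordinates; for a non-parabolic hull curve the configuration is a unit-distance-type incidence problem.) -/
def CartesianParabolaWorstCase : Prop := CartesianParabolaBound → ThreeSetBound

/-! ### 3. Registered stubs -/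

/-- STUB 1 = THE LAW, registered in LANDING form (rev 3; crux of the line; conjecture-grade, 0 provers).  Provers attacking the
stronger incidence form `LowParallelismLaw` (the literature-facing statement) close this stub through `landingLaw_of_law`. -/
theorem stub_lowParallelismLandingLaw : LowParallelismLandingLaw := by
  sorry

/-- Points of `A × B` on one non-vertical line number at most `#A` (the abscissa determines the point). -/
theorem card_ptsOn_le (A B : Finset ℝ) (s c : ℝ) :
    (((A ×ˢ B).filter fun x : ℝ × ℝ => x.2 = s * x.1 + c).card) ≤ A.card :=
  Summit.ValiantsHypothesis.ValiantsHypothesis.Theorems.NewtonFramesNewtonTauWeak.LowParallelism.card_ptsOn_le A B s c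

/-- The incidence count is the sum over the lines of the per-line point counts. -/
theorem card_incTriples_eq_sum (A B : Finset ℝ) (L : Finset (ℝ × ℝ)) :
    (incTriples A B L).card = ∑ l ∈ L, ((A ×ˢ B).filter fun x : ℝ × ℝ => x.2 = l.1 * x.1 + l.2).card :=
  Summit.ValiantsHypothesis.ValiantsHypothesis.Theorems.NewtonFramesNewtonTauWeak.LowParallelism.card_incTriples_eq_sum A B L

/-- STUB 2 = the grid witness — PROVED (S/M): `CappedSlopeSum.card_linePts_le` (high slopes) + `CappedSlopeSum.mem_lowSlopes`
(low slopes are `≤ (2H+1)H` in number, each carrying `≤ K` lines of `≤ n` points). -/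
theorem stub_gridWitness : GridLowParallelism :=
  Summit.ValiantsHypothesis.ValiantsHypothesis.Theorems.NewtonFramesNewtonTauWeak.LowParallelism.gridWitness

/-- STUB 3 = residual₁ (declared, never staffed). -/
theorem stub_cartesianParabolaWorstCase : CartesianParabolaWorstCase := by
  sorry

/-- STUB 4 = residual₂ = the record's `ResidualSlope` (declared, never staffed). -/
theorem stub_residualSlope : ResidualSlope := by
  sorry

/-! ### 4. The cap reduction (PROVED): `LowParallelismLaw → CartesianParabolaBound` -/

/-- Landings are at most incidences. -/
theorem card_landings_le_incTriples (A B : Finset ℝ) (L : Finset (ℝ × ℝ)) :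
    (landings A B L).card ≤ (incTriples A B L).card := Finset.card_image_le

/-- **THE CAP REDUCTION (U2 of the line, PROVED).**  `LowParallelismLandingLaw → CartesianParabolaBound` with `η = θ`,
`C' = C + 1`: slopes carrying more than `K = (n+2)^{1/3+θ}` lines are at most `n²/K` in number and contribute at most
`n` landings each (one per abscissa), i.e. `≤ n³/K ≤ (n+2)^{8/3-θ}`; the remaining lines form a low-parallelism set,
whose landings are `≤ C (n+2)^{8/3-θ}` by the (landing) law. -/
theorem capReductionLanding : LowParallelismLandingLaw → CartesianParabolaBound :=
  fun h => Summit.ValiantsHypothesis.ValiantsHypothesis.Theorems.NewtonFramesNewtonTauWeak.LowParallelism.capReductionLanding h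

/-- The incidence law implies the landing law (landings ≤ incidences). -/
theorem landingLaw_of_law : LowParallelismLaw → LowParallelismLandingLaw := by
  rintro ⟨θ, C, hθ, hlaw⟩
  refine ⟨θ, C, hθ, fun n A B L hA hB hL hpar => ?_⟩
  exact le_trans (by exact_mod_cast card_landings_le_incTriples A B L) (hlaw n A B L hA hB hL hpar)

/-- The cap reduction from the (stronger) incidence law. -/
theorem capReduction : LowParallelismLaw → CartesianParabolaBound :=
  fun h => capReductionLanding (landingLaw_of_law h)

/-- Dropping the parallelism hypothesis: the rung implies the landing law trivially. -/
theorem landingLaw_of_cartesianParabolaBound : CartesianParabolaBound → LowParallelismLandingLaw := by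
  rintro ⟨η, C, hη, h⟩
  exact ⟨η, C, hη, fun n A B L hA hB hL _ => h n A B L hA hB hL⟩

/-- HONESTY (rev 3): the registered law is the rung `CartesianParabolaBound` in "WLOG low parallelism" form — the proved content of
the lever is exactly the WLOG (`capReductionLanding`); what remains open is the rung itself, now attackable under a free structural
hypothesis that every known extremiser violates. -/
theorem landingLaw_iff_cartesianParabolaBound : LowParallelismLandingLaw ↔ CartesianParabolaBound :=
  ⟨capReductionLanding, landingLaw_of_cartesianParabolaBound⟩

/-! ### 5. On-path honesty (PROVED): the Cartesian–parabola rung IS a special case of `ThreeSetBound` -/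

/-- **The dictionary `Φ(x,y) = (x, y - x²)`, verbatim direction `ThreeSetBound → CartesianParabolaBound`.**
Given `A, B, L`, put `P₁ = {(a,a²)}`, `P₂ = {(0,b)}`, `Y = {(μ/2, μ²/4 - ν)}`, `S = {(x,x²) : x ∈ landings}`:
then `#Y ≤ #L`, `S ⊆ P₁ + P₂ + Y` (for an incidence `b = μa + ν`:
`(a + μ/2, (a + μ/2)²) = (a,a²) + (0,b) + (μ/2, μ²/4 - ν)`), `S` is convexly independent (parabola), `#S = #landings`. -/
theorem parabolaDictionary : ThreeSetBound → CartesianParabolaBound :=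
  fun h => Summit.ValiantsHypothesis.ValiantsHypothesis.Theorems.NewtonFramesNewtonTauWeak.LowParallelism.parabolaDictionary h

/-! ### 6. Compositions (kernel-checked, no sorry of their own) -/

/-- The Cartesian–parabola rung from the LAW (PROVED reduction). -/
theorem cartesianParabolaBound_of (h : LowParallelismLaw) : CartesianParabolaBound := capReduction h

/-- `ThreeSetBound` (the LAW of line `landing-collapse`, U1 there) from this line's LAW through residual₁. -/
theorem threeSetBound_of (h : LowParallelismLaw) (hw : CartesianParabolaWorstCase) : ThreeSetBound :=
  hw (capReduction h)

/-- THE RUNG `BeatTwoThirds` from this line's LAW through residual₁ and the LANDED chain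
`Theorems.…LandingCollapse.beatTwoThirds_of_threeSetBound` (p600179) ∘ `SlopeLadderBlocking.stub_blocking` (p578760), BY NAME. -/
theorem beatTwoThirds_of (h : LowParallelismLaw) (hw : CartesianParabolaWorstCase) : BeatTwoThirds :=
  Summit.ValiantsHypothesis.ValiantsHypothesis.Theorems.NewtonFramesNewtonTauWeak.LandingCollapse.beatTwoThirds_of_threeSetBound
    (threeSetBound_of h hw)

/-- **THE LINE CONCLUDES THE CRUX BY NAME**, through the two declared residuals. -/
theorem NewtonTauWeak_of (h : LowParallelismLaw) (hw : CartesianParabolaWorstCase) (hres : ResidualSlope) :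
    Summit.ValiantsHypothesis.ValiantsHypothesis.Theses.NewtonFrames.NewtonTauWeak :=
  hres (beatTwoThirds_of h hw)

/-- The same chain from the REGISTERED (landing-form) law. -/
theorem threeSetBound_ofLanding (h : LowParallelismLandingLaw) (hw : CartesianParabolaWorstCase) : ThreeSetBound :=
  hw (capReductionLanding h)

theorem beatTwoThirds_ofLanding (h : LowParallelismLandingLaw) (hw : CartesianParabolaWorstCase) : BeatTwoThirds :=
  Summit.ValiantsHypothesis.ValiantsHypothesis.Theorems.NewtonFramesNewtonTauWeak.LandingCollapse.beatTwoThirds_of_threeSetBound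
    (threeSetBound_ofLanding h hw)

/-- **THE LINE CONCLUDES THE CRUX BY NAME from its REGISTERED stubs** (landing law + two declared residuals). -/
theorem NewtonTauWeak_ofLanding (h : LowParallelismLandingLaw) (hw : CartesianParabolaWorstCase) (hres : ResidualSlope) :
    Summit.ValiantsHypothesis.ValiantsHypothesis.Theses.NewtonFrames.NewtonTauWeak :=
  hres (beatTwoThirds_ofLanding h hw)

/-- Same with every input discharged by its registered stub. -/
theorem NewtonTauWeak_proof : Summit.ValiantsHypothesis.ValiantsHypothesis.Theses.NewtonFrames.NewtonTauWeak :=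
  NewtonTauWeak_ofLanding stub_lowParallelismLandingLaw stub_cartesianParabolaWorstCase stub_residualSlope

/-- On-path: the rung of this line is implied by `ThreeSetBound` (so it is GENUINELY weaker-or-equal, not a costume). -/
theorem cartesianParabolaBound_of_threeSetBound (h : ThreeSetBound) : CartesianParabolaBound := parabolaDictionary h

/-! ### 7. Rev 2 — the failure mode, typed: pencils (PROVED bound) and the general-position / rich-pencil split (PROVED glue)

The card's "why it might fail" is many simultaneously RICH PENCILS.  This section quantifies it and types the foreseen two-layer
plan WITHOUT filing new items: `LowParallelismLawAt θ C ⇐ LowParallelismLawGenPosAt θ C₁ ∧ RichPencilBoundAt θ C₂` (glue proved,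
`lawAt_of_split`), where the general-position piece adds the hypothesis "no point on more than `(n+2)^{1-θ}` lines of `L`"
(Solymosi-type general position, medium-rich regime) and the pencil piece bounds the incidences carried by the lines through the
`(n+2)^{1-θ}`-heavy centres.  `card_incTriples_pencil_le` (PROVED): ONE pencil carries `≤ #A·#B + #L ≤ 2n²` incidences, so the pencil
piece can only fail through `≥ n^{2/3-θ}/2` centres whose pencils are SIMULTANEOUSLY rich (pinned quotient sets
`#((B - y_z)/(A - x_z)) ≲ n^{4/3+θ}`), the sum–product scenario named on the card. -/

/-- Concurrency multiplicity: the number of lines of `L` through the point `z = (x, y)`. -/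
def concMult (L : Finset (ℝ × ℝ)) (z : ℝ × ℝ) : ℕ := (L.filter fun l => z.2 = l.1 * z.1 + l.2).card

/-- PENCIL BOUND (PROVED): if every line of `L` passes through `z`, then `I(A × B, L) ≤ #A·#B + #L` — a point `≠ z` lies on at
most one line of the pencil, and `z` itself lies on `#L` of them. -/
theorem card_incTriples_pencil_le (A B : Finset ℝ) (L : Finset (ℝ × ℝ)) (z : ℝ × ℝ)
    (hz : ∀ l ∈ L, z.2 = l.1 * z.1 + l.2) :
    (incTriples A B L).card ≤ A.card * B.card + L.card :=
  Summit.ValiantsHypothesis.ValiantsHypothesis.Theorems.NewtonFramesNewtonTauWeak.LowParallelism.card_incTriples_pencil_le A B L z hz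

/-- The law at a fixed exponent / constant (the telescope of `LowParallelismLaw`). -/
def LowParallelismLawAt (θ C : ℝ) : Prop :=
  ∀ (n : ℕ) (A B : Finset ℝ) (L : Finset (ℝ × ℝ)),
    A.card ≤ n → B.card ≤ n → L.card ≤ n ^ 2 →
    (∀ μ : ℝ, (slopeMult L μ : ℝ) ≤ ((n : ℝ) + 2) ^ ((1 : ℝ) / 3 + θ)) →
      ((incTriples A B L).card : ℝ) ≤ C * ((n : ℝ) + 2) ^ ((8 : ℝ) / 3 - θ)

theorem law_of_lawAt {θ C : ℝ} (hθ : 0 < θ) (h : LowParallelismLawAt θ C) : LowParallelismLaw := ⟨θ, C, hθ, h⟩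

/-- The LANDING law at a fixed exponent / constant (telescope of the registered `LowParallelismLandingLaw`). -/
def LowParallelismLandingLawAt (θ C : ℝ) : Prop :=
  ∀ (n : ℕ) (A B : Finset ℝ) (L : Finset (ℝ × ℝ)),
    A.card ≤ n → B.card ≤ n → L.card ≤ n ^ 2 →
    (∀ μ : ℝ, (slopeMult L μ : ℝ) ≤ ((n : ℝ) + 2) ^ ((1 : ℝ) / 3 + θ)) →
      ((landings A B L).card : ℝ) ≤ C * ((n : ℝ) + 2) ^ ((8 : ℝ) / 3 - θ)

theorem landingLaw_of_landingLawAt {θ C : ℝ} (hθ : 0 < θ) (h : LowParallelismLandingLawAt θ C) :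
    LowParallelismLandingLaw := ⟨θ, C, hθ, h⟩

/-- landings ≤ incidences, exponent by exponent. -/
theorem landingLawAt_of_lawAt {θ C : ℝ} (h : LowParallelismLawAt θ C) : LowParallelismLandingLawAt θ C := by
  intro n A B L hA hB hL hcap
  have h1 : ((landings A B L).card : ℝ) ≤ (incTriples A B L).card := by exact_mod_cast Finset.card_image_le
  exact h1.trans (h n A B L hA hB hL hcap)

/-- ★ **THE `θ = 0` ENDPOINT IS A TREE THEOREM (rev 5).**  `LowParallelismLawAt 0 C` holds for some `C` — with NO use of
the parallelism hypothesis: it is the Szemerédi–Trotter bound for `n × n` Cartesian products against `≤ n²` lines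
(`O((n+2)^{8/3})` incidences), proved ELEMENTARILY in `Theorems/NewtonFramesCartesianIncidenceBound.lean`
(`…CartesianIncidence.card_incidences_le_rpow`: order-block grid cutting + `K₂,₂`-free Cauchy–Schwarz; no crossing lemma).
So the registered LAW is now literally "any `θ > 0` beyond a PROVED `θ = 0`": the measured deficit of the line
(`8/3 − θ` wanted vs `8/3` proved) lives in the tree, not in print. -/
theorem lawAt_zero : ∃ C : ℝ, LowParallelismLawAt 0 C := by
  obtain ⟨C, -, hC⟩ :=
    Summit.ValiantsHypothesis.ValiantsHypothesis.Theorems.NewtonFramesNewtonTauWeak.CartesianIncidence.card_incidences_le_rpow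
  refine ⟨C, fun n A B L hA hB hL _ => ?_⟩
  have h := hC n A B L hA hB hL
  rw [sub_zero]
  exact h

/-- The `θ = 0` endpoint of the REGISTERED (landing) law, by name. -/
theorem landingLawAt_zero : ∃ C : ℝ, LowParallelismLandingLawAt 0 C :=
  lawAt_zero.imp fun _ h => landingLawAt_of_lawAt h

/-- GENERAL-POSITION PIECE (typed; the natural first prover/refuter target, WEAKER than the law — `genPosAt_of_lawAt`):
the law under the extra hypothesis that no point lies on more than `(n+2)^{1-θ}` lines of `L`. -/
def LowParallelismLawGenPosAt (θ C : ℝ) : Prop :=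
  ∀ (n : ℕ) (A B : Finset ℝ) (L : Finset (ℝ × ℝ)),
    A.card ≤ n → B.card ≤ n → L.card ≤ n ^ 2 →
    (∀ μ : ℝ, (slopeMult L μ : ℝ) ≤ ((n : ℝ) + 2) ^ ((1 : ℝ) / 3 + θ)) →
    (∀ z : ℝ × ℝ, (concMult L z : ℝ) ≤ ((n : ℝ) + 2) ^ ((1 : ℝ) - θ)) →
      ((incTriples A B L).card : ℝ) ≤ C * ((n : ℝ) + 2) ^ ((8 : ℝ) / 3 - θ)

/-- `∃`-form of the general-position piece. -/
def LowParallelismLawGenPos : Prop := ∃ (θ C : ℝ), 0 < θ ∧ LowParallelismLawGenPosAt θ C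

open Classical in
/-- RICH-PENCIL PIECE (typed): for ANY set `Z` of `(n+2)^{1-θ}`-heavy centres, the lines of `L` through `Z` carry
`≤ C (n+2)^{8/3-θ}` incidences with `A × B` (low parallelism assumed).  By `card_incTriples_pencil_le` this can fail only through
`≥ n^{2/3-θ}/2` simultaneously rich pencils — a pinned sum–product configuration. -/
def RichPencilBoundAt (θ C : ℝ) : Prop :=
  ∀ (n : ℕ) (A B : Finset ℝ) (L : Finset (ℝ × ℝ)),
    A.card ≤ n → B.card ≤ n → L.card ≤ n ^ 2 →
    (∀ μ : ℝ, (slopeMult L μ : ℝ) ≤ ((n : ℝ) + 2) ^ ((1 : ℝ) / 3 + θ)) →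
    ∀ Z : Set (ℝ × ℝ), (∀ z ∈ Z, ((n : ℝ) + 2) ^ ((1 : ℝ) - θ) < (concMult L z : ℝ)) →
      ((incTriples A B (L.filter fun l => ∃ z ∈ Z, z.2 = l.1 * z.1 + l.2)).card : ℝ) ≤
        C * ((n : ℝ) + 2) ^ ((8 : ℝ) / 3 - θ)

/-- `∃`-form of the rich-pencil piece. -/
def RichPencilBound : Prop := ∃ (θ C : ℝ), 0 < θ ∧ RichPencilBoundAt θ C

theorem genPosAt_of_lawAt {θ C : ℝ} (h : LowParallelismLawAt θ C) : LowParallelismLawGenPosAt θ C :=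
  fun n A B L hA hB hL hpar _ => h n A B L hA hB hL hpar

theorem genPos_of_law (h : LowParallelismLaw) : LowParallelismLawGenPos := by
  obtain ⟨θ, C, hθ, h⟩ := h
  exact ⟨θ, C, hθ, genPosAt_of_lawAt h⟩

/-- Splitting the incidence count along a partition of the line set. -/
theorem card_incTriples_filter_add (A B : Finset ℝ) (L : Finset (ℝ × ℝ)) (P : ℝ × ℝ → Prop) [DecidablePred P] :
    (incTriples A B (L.filter P)).card + (incTriples A B (L.filter fun l => ¬ P l)).card = (incTriples A B L).card := by
  classical
  rw [card_incTriples_eq_sum, card_incTriples_eq_sum, card_incTriples_eq_sum]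
  exact Finset.sum_filter_add_sum_filter_not L P _

/-- THE GLUE OF THE FORESEEN SPLIT (PROVED): general position + rich pencils ⇒ the law, at the same exponent. -/
theorem lawAt_of_split {θ C₁ C₂ : ℝ} (h₁ : LowParallelismLawGenPosAt θ C₁) (h₂ : RichPencilBoundAt θ C₂) :
    LowParallelismLawAt θ (C₁ + C₂) := by
  classical
  intro n A B L hA hB hL hpar
  have hX : (0 : ℝ) ≤ ((n : ℝ) + 2) ^ ((1 : ℝ) - θ) := Real.rpow_nonneg (by positivity) _
  -- the heavy centres and the lines through them
  let Z : Set (ℝ × ℝ) := {z | ((n : ℝ) + 2) ^ ((1 : ℝ) - θ) < (concMult L z : ℝ)}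
  let P : ℝ × ℝ → Prop := fun l => ∃ z ∈ Z, z.2 = l.1 * z.1 + l.2
  have hsplit := card_incTriples_filter_add A B L P
  -- general-position piece on the lines avoiding every heavy centre
  have hgen : ((incTriples A B (L.filter fun l => ¬ P l)).card : ℝ) ≤ C₁ * ((n : ℝ) + 2) ^ ((8 : ℝ) / 3 - θ) := by
    refine h₁ n A B _ hA hB ((Finset.card_le_card (Finset.filter_subset _ L)).trans hL) (fun μ => ?_) (fun z => ?_)
    · refine le_trans ?_ (hpar μ)
      exact_mod_cast Finset.card_le_card (Finset.filter_subset_filter _ (Finset.filter_subset _ L))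
    · by_cases hz : ((n : ℝ) + 2) ^ ((1 : ℝ) - θ) < (concMult L z : ℝ)
      · have h0 : concMult (L.filter fun l => ¬ P l) z = 0 := by
          unfold concMult
          rw [Finset.card_eq_zero, Finset.filter_eq_empty_iff]
          intro l hl hzl
          exact (Finset.mem_filter.1 hl).2 ⟨z, hz, hzl⟩
        rw [h0, Nat.cast_zero]
        exact hX
      · rw [not_lt] at hz
        refine le_trans ?_ hz
        exact_mod_cast Finset.card_le_card (Finset.filter_subset_filter _ (Finset.filter_subset _ L))
  -- rich-pencil piece on the lines through the heavy centres
  have hconc : ((incTriples A B (L.filter P)).card : ℝ) ≤ C₂ * ((n : ℝ) + 2) ^ ((8 : ℝ) / 3 - θ) :=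
    h₂ n A B L hA hB hL hpar Z (fun z hz => hz)
  have hcast : ((incTriples A B L).card : ℝ) =
      ((incTriples A B (L.filter P)).card : ℝ) + ((incTriples A B (L.filter fun l => ¬ P l)).card : ℝ) := by
    rw [← hsplit, Nat.cast_add]
  rw [hcast, add_mul]
  linarith

/-- `∃`-packaging of the split: both pieces at a common exponent give the law. -/
theorem law_of_split (h : ∃ (θ C₁ C₂ : ℝ), 0 < θ ∧ LowParallelismLawGenPosAt θ C₁ ∧ RichPencilBoundAt θ C₂) :
    LowParallelismLaw := by
  obtain ⟨θ, C₁, C₂, hθ, h₁, h₂⟩ := h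
  exact law_of_lawAt hθ (lawAt_of_split h₁ h₂)

/-- The crux BY NAME from the two pieces of the split (plus the declared residuals). -/
theorem NewtonTauWeak_of_split
    (h : ∃ (θ C₁ C₂ : ℝ), 0 < θ ∧ LowParallelismLawGenPosAt θ C₁ ∧ RichPencilBoundAt θ C₂)
    (hw : CartesianParabolaWorstCase) (hres : ResidualSlope) :
    Summit.ValiantsHypothesis.ValiantsHypothesis.Theses.NewtonFrames.NewtonTauWeak :=
  NewtonTauWeak_of (law_of_split h) hw hres

/-- One pencil through a heavy centre is harmless: `≤ #A·#B + #L` (instance of `card_incTriples_pencil_le` for the filtered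
line set), so the rich-pencil piece is about MANY simultaneously rich pencils. -/
theorem card_incTriples_through_le (A B : Finset ℝ) (L : Finset (ℝ × ℝ)) (z : ℝ × ℝ) :
    (incTriples A B (L.filter fun l => z.2 = l.1 * z.1 + l.2)).card ≤ A.card * B.card + L.card := by
  classical
  refine (card_incTriples_pencil_le A B _ z (fun l hl => (Finset.mem_filter.1 hl).2)).trans ?_
  exact Nat.add_le_add_left (Finset.card_le_card (Finset.filter_subset _ L)) _

end Summit.ValiantsHypothesis.ValiantsHypothesis.Cruxes.NewtonTauWeak.LowParallelism

end
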